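import Literature.Computability.MetaComplexity.EFModMulURange
import Literature.Computability.MetaComplexity.EFDerives
import HarnessLib

/-!
# The laws of uniform modular addition in compositional form

The block laws of the uniform modular adder (`EFModAddULaws.lean`, `EFModAddUAssocKit.lean`,
`EFModMulURange.lean`) restated as `FregeSystem.Yields` derivations (`EFDerives.lean`: a block
over the available set, of bounded size, after which the conclusions are available), the form
in which the linearity laws of modular multiplication compose them:

* `ModAddU.yields_leib` — congruence: `R(M₁) ≡ R(M₂)` bitwise from bitwise equal operands;
* `ModAddU.yields_comm` — commutativity;
* `ModAddU.yields_lt` — the range law (`R < n` from `a, b < n`);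
* `ModAddU.yields_transfer` — transfer of `<` between comparators on the same operands;
* `ModAddU.yields_high` — high bits of a word `< n` with a small modulus (`negHigh`);
* `ModAddU.yields_kit` — associativity of an available kit occurrence.

## Sources

* S. A. Cook, R. A. Reckhow, *The relative efficiency of propositional proof systems*,
  J. Symbolic Logic 44 (1979), §2.
-/

namespace Literature.Computability.MetaComplexity

open _root_.Computability Complexity Complexity.PropForm Netlist FregeSystem

namespace ModAddU

variable {G : FregeSystem} {K : PropForm ℕ} {T : Set (PropForm ℕ)} {L : ℕ}

/-- **Congruence of modular addition**, compositional form. [cite: CookReckhow1979, §2] -/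
theorem yields_leib (hGN : ∀ r ∈ Netlist.rules, r ∈ G.rules) (hGL : ∀ r ∈ Logic.rules, r ∈ G.rules) (M₁ M₂ : View)
    (h₁ : M₁.Avail K T L) (h₂ : M₂.Avail K T L) (ha : Holds K T (eqW M₁.a M₂.a L)) (hb : Holds K T (eqW M₁.b M₂.b L))
    (hn : Holds K T (eqW M₁.n M₂.n L)) : G.Yields T (ctxSet K (eqW (M₁.R L) (M₂.R L) L)) ((6 * L + 2) * (K.size + 10)) := by
  let d : PairData := ⟨M₁, M₂, L⟩
  refine Yields.of_isBlock (d.isBlock_leibLines hGN hGL h₁ h₂ (holds_eqW_iff.1 ha) (holds_eqW_iff.1 hb)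
    (holds_eqW_iff.1 hn)) ?_ d.proofSize_leibLines
  rintro θ ⟨Lb, hLb, rfl⟩
  obtain ⟨i, hi, rfl⟩ := List.mem_map.1 hLb
  exact d.mem_leibLines (List.mem_range.1 hi)

/-- **Commutativity of modular addition**, compositional form. [cite: CookReckhow1979, §2] -/
theorem yields_comm (hGN : ∀ r ∈ Netlist.rules, r ∈ G.rules) (hGA : ∀ r ∈ Adder.rules, r ∈ G.rules)
    (hGL : ∀ r ∈ Logic.rules, r ∈ G.rules) (M₁ M₂ : View) (h₁ : M₁.Avail K T L) (h₂ : M₂.Avail K T L)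
    (hab : Holds K T (eqW M₁.a M₂.b L)) (hba : Holds K T (eqW M₁.b M₂.a L)) (hn : Holds K T (eqW M₁.n M₂.n L)) :
    G.Yields T (ctxSet K (eqW (M₁.R L) (M₂.R L) L)) ((6 * L + 2) * (K.size + 10)) := by
  let d : PairData := ⟨M₁, M₂, L⟩
  refine Yields.of_isBlock (d.isBlock_commLines hGN hGA hGL h₁ h₂ (holds_eqW_iff.1 hab) (holds_eqW_iff.1 hba)
    (holds_eqW_iff.1 hn)) ?_ d.proofSize_commLines
  rintro θ ⟨Lb, hLb, rfl⟩
  obtain ⟨i, hi, rfl⟩ := List.mem_map.1 hLb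
  exact d.mem_commLines (List.mem_range.1 hi)

/-- **The range law of modular addition**, compositional form: `R < n` from `a, b < n`.
[cite: CookReckhow1979, §2] -/
theorem yields_lt (hG : ∀ r ∈ rules, r ∈ G.rules) (hGA : ∀ r ∈ Adder.rules, r ∈ G.rules) (M : View) (bA bB bC : ℕ)
    (hM : M.Avail K T L) (hA : (⟨bA, M.a, M.n⟩ : Sub.View).Avail K T L) (hB : (⟨bB, M.b, M.n⟩ : Sub.View).Avail K T L)
    (hC : (⟨bC, M.R L, M.n⟩ : Sub.View).Avail K T L)
    (ha : ctx K (neg (var ((⟨bA, M.a, M.n⟩ : Sub.View).ge L L))) ∈ T)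
    (hb : ctx K (neg (var ((⟨bB, M.b, M.n⟩ : Sub.View).ge L L))) ∈ T) :
    G.Yields T {ctx K (neg (var ((⟨bC, M.R L, M.n⟩ : Sub.View).ge L L)))} ((L + 3) * (K.size + 153)) := by
  let d : LtData := ⟨M, L, bA, bB, bC⟩
  refine Yields.of_isBlock (d.isBlock_lines hG hGA hM hA hB hC ha hb) ?_ d.proofSize_lines
  rintro θ rfl
  exact d.mem_lines

/-- **Transfer of a strict comparison**, compositional form. [cite: CookReckhow1979, §2] -/
theorem yields_transfer (hGN : ∀ r ∈ Netlist.rules, r ∈ G.rules) (hGA : ∀ r ∈ Adder.rules, r ∈ G.rules)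
    (hGL : ∀ r ∈ Logic.rules, r ∈ G.rules) (A' A : Sub.View) (hA' : A'.Avail K T L) (hA : A.Avail K T L)
    (hx : ∀ i < L, A'.x i = A.x i) (hy : ∀ i < L, A'.y i = A.y i) (hlt : ctx K (neg (var (A'.ge L L))) ∈ T) :
    G.Yields T {ctx K (neg (var (A.ge L L)))} ((5 * L + 2) * (K.size + 10)) := by
  refine Yields.of_isBlock (AssocKit.isBlock_transferLines hGN hGA hGL hA' hA hx hy hlt) ?_
    (AssocKit.proofSize_transferLines A' A K L)
  rintro θ rfl
  exact AssocKit.mem_transferLines A' A K L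

/-- The bodies `¬x_{L-1}, …, ¬x_m` (high bits, top first). [folklore] -/
def negHigh (x : ℕ → ℕ) (L m : ℕ) : List (PropForm ℕ) := (List.range (L - m)).map fun j => neg (var (x (L - 1 - j)))

/-- Reading the high-bit facts off an available `negHigh`. [folklore] -/
theorem neg_of_negHigh {x : ℕ → ℕ} {L m : ℕ} {T : Set (PropForm ℕ)} (h : ctxSet K (negHigh x L m) ⊆ T) :
    ∀ i, m ≤ i → i < L → ctx K (neg (var (x i))) ∈ T := fun i hm hi =>
  h ⟨_, List.mem_map.2 ⟨L - 1 - i, List.mem_range.2 (by omega), by rw [show L - 1 - (L - 1 - i) = i by omega]⟩, rfl⟩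

/-- **High bits of a word below a small modulus**, compositional form. [cite: CookReckhow1979, §2] -/
theorem yields_high (hG : ∀ r ∈ ModMulU.rangeRules, r ∈ G.rules) (C : Sub.View) {m : ℕ} (hC : C.Avail K T L)
    (hy : ∀ i, m ≤ i → i < L → ctx K (neg (var (C.y i))) ∈ T) (hlt : ctx K (neg (var (C.ge L L))) ∈ T) :
    G.Yields T (ctxSet K (negHigh C.x L m)) (2 * L * (K.size + 3)) := by
  refine Yields.of_isBlock (ModMulU.isBlock_highLines hG hC hy hlt) ?_ (ModMulU.proofSize_highLines C K L m)
  rintro θ ⟨Lb, hLb, rfl⟩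
  obtain ⟨j, hj, rfl⟩ := List.mem_map.1 hLb
  exact List.mem_append_right _ (List.mem_map.2 ⟨j, hj, rfl⟩)

/-- **Associativity of an available kit occurrence**, compositional form. [cite: CookReckhow1979, §2] -/
theorem yields_kit (hG : ∀ r ∈ assocRules, r ∈ G.rules) (hGN : ∀ r ∈ Netlist.rules, r ∈ G.rules)
    (hGA : ∀ r ∈ Adder.rules, r ∈ G.rules) (hGL : ∀ r ∈ Logic.rules, r ∈ G.rules)
    (hGG : ∀ r ∈ glueRules, r ∈ G.rules) (o : Occ) (ho : o.Avail (AssocKit.kitT L) (4 * L) K T) {m : ℕ} (hm : m + 2 ≤ L)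
    (ha : ∀ i, m ≤ i → i < L → ctx K (neg (var (o.inp i))) ∈ T)
    (hb : ∀ i, m ≤ i → i < L → ctx K (neg (var (o.inp (L + i)))) ∈ T)
    (hc : ∀ i, m ≤ i → i < L → ctx K (neg (var (o.inp (2 * L + i)))) ∈ T)
    (hA : ctx K (neg (var ((AssocKit.data o L).A.ge L L))) ∈ T) (hC : ctx K (neg (var ((AssocKit.data o L).C.ge L L))) ∈ T) :
    G.Yields T (ctxSet K (eqW (AssocKit.out₂ o L) (AssocKit.out₄ o L) L)) ((82 * L + 65) * (K.size + 140)) := by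
  refine Yields.of_isBlock (AssocKit.isBlock hG hGN hGA hGL hGG ho hm ha hb hc hA hC) ?_ AssocKit.proofSize_le
  rintro θ ⟨Lb, hLb, rfl⟩
  obtain ⟨i, hi, rfl⟩ := List.mem_map.1 hLb
  exact AssocKit.mem (List.mem_range.1 hi)

end ModAddU

end Literature.Computability.MetaComplexity
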